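import Summits.QuantumFields.BalabanUV.Beta.GAN24.T2ShapeEvenEnd
import Summits.QuantumFields.BalabanUV.Beta.GAN24.HalfMemberSlavedDivergence
import Summits.QuantumFields.BalabanUV.Beta.GAN24.T2DevConservationDriftRows
import Summits.QuantumFields.BalabanUV.Beta.GAN24.T2DevCovariance
import Summits.QuantumFields.BalabanUV.Beta.GAN24.T2UnitSplitFrom
import Summits.QuantumFields.BalabanUV.Beta.GAN24.T2UnitSplitShapes

/-!
# `BalabanUV.Beta.GAN24.T2DriftEvenEnd` — binder row G-an2-4 ∕ (CONV-C), W-slot EXIT (α) «use the identity, not its defect» (RULING R-lead-g77-1 (2);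
# the OWNER's RULING R-gan24p1-g33-1 + A1, INTENT I-gan24p1-g33-3 piece (α-END-c′)): **THE DRIFT TWIN of `T2ShapeEvenEnd` — «T2Drift» OF THE PARITY
# `ε`-MEMBER `y_n = ½ • (T̃_n + ε • P T̃_n)` of an2's comb `T₂` tower at `d = 3`**, road W3's END #2 (`TransportRows.rate_three_of_rows_F3b`) run on the DIFFERENCE
# tower of the `ε`-member through the SHIFTED UNDRESSED transport, at the EXACT pin `cE₂ = +Lc⁸` (row owner `b2b-balaban-gan24-p1`, gen 34)

NOT IN PRINT; OUR BOOKKEEPING ([folklore] composition BY NAME; 0 `def`, 0 cited facts, 0 `def … : Prop`, 0 sorry).  HONEST FRAMING (cell contract, verbatim):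
«discharging `BetaPertH` makes Bałaban's UV stability UNCONDITIONAL — a real constructive-QFT result; it is NOT the continuum limit and NOT the Clay problem.»
HONEST DEPENDENCY (verbatim): «continuum YM on T⁴ ⇐ BetaPertH ∧ nine spine estimates (0/9 proved); BetaPertH ⇐ (D1) ∧ (D4) ∧ CAP+tail; G-an2-4 gates asym, D1
and NE2/3/4.»

WHAT.  Objects as in the shape END `GAN24/T2ShapeEvenEnd` (in-block root `r`, adopted units, `c₄ = cE₂·Lc^8`): `T̃_n := unitS₂_n (T2RecAt 3 Lc ρ … n)`, `y_n := ½ • (T̃_n +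
ε • P T̃_n)` (`P := sgnK ∘ trK` slotwise; `ε = 1` the EVEN member), `𝒜^Ĝ_l` ∕ `𝒜^K_l := lin4 c₄ (unitK_l Ĝ_l ∕ K_l) Lc` (dressed ∕ road W3's undressed step), the
RELATIVE source `b^{rel,ε}_l := ½ • (b̃_l + ε • P b̃_l) + (𝒜^Ĝ_l y_l − 𝒜^K_l y_l)` ((R-HYB′) currency).
* §1 (generic `d`) `zsym_lin4_step_eq` ∕ `zfreeSym_lin4_sub_self` ∕ **`zfreeSym_succ_sub`** — AT THE CONSERVING SCALAR (`Lc^{d+1}·c·½·Lc^{−4(d+2)}·2 = 1`; at `d = 3`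
  the EXACT pin `cE₂ = +Lc⁸`, `pinConst_three`) the undressed unit step CONSERVES the bond-symmetrised ff charge of EVERY jointly `Lc`-covariant `LocStencil₂` table
  (leaf-18's `Lin4ZeroMode.zmode_lin4_step`, any level), so `𝒜^K_j X − X` and the first difference `X′ − X` of any one-step recursion `X′ = 𝒜^K_j X + G` with
  `ZfreeSym` source `G` carry road W3's `ZfreeSym` text — its `hZ0` slot for a GENERIC member, NO charge hypothesis (leaf-04 g59's
  `T2UndressedCombChargeStep.hZ0_symZ_of_pinEq` is the comb-slot instance).
* §2 (`d = 3`) **`rate_halfMember_three_of_relSource_rows`** — THE DRIFT SOCKET INSTANCE AT THE `ε`-MEMBER (`2 ≤ Lc`, EXACT pin, every `ε`, jointly covariant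
  off-diagonal `LocStencil₂` border): the recursion `y_{j+1} = 𝒜^K_j y_j + b^{rel,ε}_j` (leaf-01 g72's HYPOTHESIS-FREE `halfMember_succ_eq` re-based on the
  undressed step, `abel`), its DIFFERENCE tower unrolled through the SHIFTED undressed transport (leaf-01's `AffineUnroll.diff_eq_transport_add_sum`, bounded
  tables), road W3's END #2 socket certificate `TransportRows.rate_three_of_rows_F3b` (F3b over road P1's `KSlotAssembly.convCKWall_holds`, `mom := 0`) with the
  forcing's RATE row = leaf-01 g63's `T2DevConservationDriftRows.exists_forcing_rate` (K-Cauchy × «T2Shape^{ε}» + the relative source's DRIFT), its `ZfreeSym` row =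
  `zfreeSym_forcing` + `hZ` at `m, m+1`, the first difference by §1 + `hZ 0` (shape by «T2Shape^{ε}»), the member's covariance by `T2DevCovariance` ⨾ shape PART 1 §1.
  DISPLAYED: «T2Shape^{ε}» `hy`; the relative source's `hb` (uniformly `LocStencil₂`) ∧ `hZ` (`ZfreeSym`) — shape PART 1's binders VERBATIM —; ONE NEW ROW **`hbd`**,
  the relative source's one-step DRIFT `LocStencil₂ (b^{rel,ε}_{l+1} − b^{rel,ε}_l) (Cbd·θb^l) δbd` ⟹ «T2Drift^{ε}» (one-step rate ∧ Cauchy form, `cauchy_of_rate`).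
PART 2 (`GAN24/T2DriftEvenEndRows`, the OWNER) discharges `hy` by the shape END, `hb`∕`hZ`'s suppliable halves as `T2ShapeEvenEndRows` does, `hbd`'s SOURCE half by p2
g35's (F4b) `T2RecSourceRows.source_rows_three_of_srecAt_rows`.2 ⨾ halves — displayed there: `hcell`, the cells' DRIFT `hcelld` ((α-END-b′), NEW), `hC`.  SERVES ((α-0)):
«T2Shape^{ev}» ∧ «T2Drift^{ev}» ⟹ p2 g45's `WrecAtEvenHalfRows(Final)` ⟹ leaf-01's `WSlotParityJunction` ⟹ the OWNER's `WSlotParityBlind` ⟹ the D1 literal's `hall`.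
CONDITIONAL on `hy`, `hb`, `hZ`, `hbd`, the exact pin; asserts NO shape of Bałaban's tables beyond those rows, NO value of any charge; discharges NOTHING of (hW, hWall)
∕ (C) ∕ (Q-L) ∕ `hcell`; (β) of record untouched (odd member); NOT «W-slot closed»; NEVER «G-an2-4 closed» as (CONV-C); NOT D1, NOT `BetaPertH`, NOT continuum,
NOT Clay.  2026-08-23.
-/

noncomputable section

open Finset
open scoped BigOperators
open Literature.MathematicalPhysics.QuantumFieldTheory
open Literature.MathematicalPhysics.QuantumFieldTheory.Balaban1983to89
open Literature.MathematicalPhysics.QuantumFieldTheory.Balaban1983to89.Beta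
open ExpKernelCalculus (MKer Decays shiftK)
open OneStepResolventKernel (Fib LocStencil)
open OneStepKernelFamily (KInvStep decays_KInvStep)
open AffineAveraging (box toSite)
open AveragingMixedJetTables (mixFFAt)
open SecondOrderResponse (W2SymOfK)
open BalabanCompositeJets (LocStencil₂ LocStencil₂.nonneg LocStencil₂.mono)
open BalabanStepJetsSucc (mmRead)
open BalabanStepW2 (K3OfK M2Of)
open Summit.QuantumFields.BalabanUV.Beta.TameKernelCalculus (trK)
open Summit.QuantumFields.BalabanUV.Beta.BorderedHessian (sgnK)
open Summit.QuantumFields.BalabanUV.Beta.HessKerDressedUnits (unitK unitS decays_unitK)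
open Summit.QuantumFields.BalabanUV.Beta.SecondOrderUnits (unitM unitS₂ unitM₂)
open Summit.QuantumFields.BalabanUV.Beta.AxialDressingRooted (coDressKBmAt)
open Summit.QuantumFields.BalabanUV.Beta.SpineRooted (T2RecAt SpureRecAt M1At)
open Summit.QuantumFields.BalabanUV.Beta.GAN24.CombesThomas (sfStep smStep UnitDecayK CauchyDecayK)
open Summit.QuantumFields.BalabanUV.Beta.GAN24.T2RecursionAffine (lin4)
open Summit.QuantumFields.BalabanUV.Beta.GAN24.AffineUnroll (transport diff_eq_transport_add_sum)
open Summit.QuantumFields.BalabanUV.Beta.GAN24.BiStencilZeroMode (Tab zmode)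
open Summit.QuantumFields.BalabanUV.Beta.GAN24.Push4Iter (BiTab)
open Summit.QuantumFields.BalabanUV.Beta.GAN24.KSlotAssembly (convCKWall_holds)
open Summit.QuantumFields.BalabanUV.Beta.GAN24.TransportRows (rate_three_of_rows_F3b)
open Summit.QuantumFields.BalabanUV.Beta.GAN24.WSlotT2OfPieces (cauchy_of_rate locStencil₂_add)
open Summit.QuantumFields.BalabanUV.Beta.GAN24.WSlotForcingZeroMode (locStencil₂_sub)
open Summit.QuantumFields.BalabanUV.Beta.GAN24.WSlotForcingZeroModeW3 (add_translate_pi sub_translate_pi)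
open Summit.QuantumFields.BalabanUV.Beta.GAN24.WSlotFirstDiff (zmode_add zmode_sub)
open Summit.QuantumFields.BalabanUV.Beta.GAN24.Lin4ZeroMode (lin4_translate shiftK_unitKInvStep zmode_lin4_step locStencil₂_lin4)
open Summit.QuantumFields.BalabanUV.Beta.GAN24.T2UnitSplitLevels (bdd₄_zero bdd₄_add bdd₄_sub)
open Summit.QuantumFields.BalabanUV.Beta.GAN24.T2UnitSplitShapes (bdd₄_of_locStencil₂)
open Summit.QuantumFields.BalabanUV.Beta.GAN24.T2UnitSplitFrom (lin4_bdd₄ lin4_add_bdd₄)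
open Summit.QuantumFields.BalabanUV.Beta.GAN24.T2DevConservationDriftRows (zfreeSym_add zfreeSym_sub zfreeSym_forcing exists_forcing_rate)
open Summit.QuantumFields.BalabanUV.Beta.GAN24.T2DevCovariance (unitS₂_T2RecAt_translate)
open Summit.QuantumFields.BalabanUV.Beta.GAN24.T2ShapeEvenEnd (translate_halfTable)
open Summit.QuantumFields.BalabanUV.Beta.GAN24.HalfMemberSlavedDivergence (halfMember_succ_eq)

namespace Summit.QuantumFields.BalabanUV.Beta.GAN24.T2DriftEvenEnd

/-! ## §1 Generic `d`: the undressed unit step conserves the symmetrised ff charge at the conserving scalar -/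

section Generic

variable {d : ℕ} {Lc : ℕ} [NeZero Lc]

/-- [folklore] **AT THE CONSERVING SCALAR THE UNDRESSED UNIT STEP CONSERVES THE BOND-SYMMETRISED ff CHARGE** of every jointly `Lc`-covariant `LocStencil₂` table `X`
(`1 ≤ Lc`, rate `δ > 0`, ANY level `j`): `zsym (lin4 c K♮_j Lc X) = zsym (X)` whenever `Lc^{d+1}·(c·½·Lc^{−4(d+2)})·2 = 1` — leaf-18's `Lin4ZeroMode.zmode_lin4_step` in
both index orders; NO hypothesis on the charge of `X`. -/
theorem zsym_lin4_step_eq (hLc : 1 ≤ Lc) (j : ℕ) {c : ℝ}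
    (hc : ((Lc : ℝ) ^ (d + 1)) * (c * ((1 / 2 : ℝ) * (((Lc : ℝ) ^ (d + 1 + 1))⁻¹) ^ 4)) * 2 = 1)
    {X : Tab d} {CT δ : ℝ} (hX : LocStencil₂ X CT δ) (hδ : 0 < δ)
    (hXcov : ∀ κ u κ' u' t, X κ (u + (Lc : ℤ) • t) κ' (u' + (Lc : ℤ) • t) = shiftK (-((Lc : ℤ) • t)) (X κ u κ' u'))
    (κ κ' κ₁ κ₂ : Fin (d + 1)) :
    zmode Lc (lin4 c (unitK (sfStep Lc j) (smStep d Lc j) (KInvStep (d := d) Lc j)) Lc X) κ κ' (Sum.inl κ₁) (Sum.inl κ₂)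
        + zmode Lc (lin4 c (unitK (sfStep Lc j) (smStep d Lc j) (KInvStep (d := d) Lc j)) Lc X) κ' κ (Sum.inl κ₁) (Sum.inl κ₂)
      = zmode Lc X κ κ' (Sum.inl κ₁) (Sum.inl κ₂) + zmode Lc X κ' κ (Sum.inl κ₁) (Sum.inl κ₂) := by
  rw [zmode_lin4_step hLc Lc j c hX hδ hXcov κ κ' κ₁ κ₂, zmode_lin4_step hLc Lc j c hX hδ hXcov κ' κ κ₁ κ₂]
  linear_combination (zmode Lc X κ κ' (Sum.inl κ₁) (Sum.inl κ₂) + zmode Lc X κ' κ (Sum.inl κ₁) (Sum.inl κ₂)) * hc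

/-- NOT IN PRINT; OUR BOOKKEEPING ([folklore] `zsym_lin4_step_eq` + leaf-07's `zmode_sub`; covariance by leaf-18's `lin4_translate` ∕ `sub_translate_pi`).  **ROAD W3's `hZ0`
SLOT FOR A GENERIC MEMBER, `ZfreeSym` CURRENCY**: at the conserving scalar, `𝒜^K_j X − X := lin4 c K♮_j Lc X − X` carries road W3's `ZfreeSym` text (jointly
`Lc`-covariant ∧ bond-symmetrised ff cell charge zero) for EVERY jointly covariant `LocStencil₂` table `X` — NO hypothesis on the charge of `X`, any level `j`. -/
theorem zfreeSym_lin4_sub_self (hLc : 1 ≤ Lc) (j : ℕ) {c : ℝ}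
    (hc : ((Lc : ℝ) ^ (d + 1)) * (c * ((1 / 2 : ℝ) * (((Lc : ℝ) ^ (d + 1 + 1))⁻¹) ^ 4)) * 2 = 1)
    {X : Tab d} {CT δ : ℝ} (hX : LocStencil₂ X CT δ) (hδ : 0 < δ)
    (hXcov : ∀ κ u κ' u' t, X κ (u + (Lc : ℤ) • t) κ' (u' + (Lc : ℤ) • t) = shiftK (-((Lc : ℤ) • t)) (X κ u κ' u')) :
    (∀ (κ : Fin (d + 1)) (u : Fin (d + 1) → ℤ) (κ' : Fin (d + 1)) (u' t : Fin (d + 1) → ℤ),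
        (lin4 c (unitK (sfStep Lc j) (smStep d Lc j) (KInvStep (d := d) Lc j)) Lc X - X) κ (u + (Lc : ℤ) • t) κ' (u' + (Lc : ℤ) • t)
          = shiftK (-((Lc : ℤ) • t)) ((lin4 c (unitK (sfStep Lc j) (smStep d Lc j) (KInvStep (d := d) Lc j)) Lc X - X) κ u κ' u')) ∧
      (∀ κ κ' κ₁ κ₂, zmode Lc (lin4 c (unitK (sfStep Lc j) (smStep d Lc j) (KInvStep (d := d) Lc j)) Lc X - X) κ κ' (Sum.inl κ₁) (Sum.inl κ₂)
          + zmode Lc (lin4 c (unitK (sfStep Lc j) (smStep d Lc j) (KInvStep (d := d) Lc j)) Lc X - X) κ' κ (Sum.inl κ₁) (Sum.inl κ₂) = 0) := by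
  obtain ⟨m, C, hm, hC, hK⟩ := decays_KInvStep (Lc := Lc) (d := d) j
  have hA := locStencil₂_lin4 (decays_unitK (sf := sfStep Lc j) (sm := smStep d Lc j) hK) (by positivity) hm hLc c hX hδ
  have hρ : 0 < min (min m δ / 128) δ := lt_min (by positivity) hδ
  refine ⟨fun κ u κ' u' t => sub_translate_pi (w := (Lc : ℤ) • t) (v := -((Lc : ℤ) • t))
      (fun κ u κ' u' => lin4_translate (shiftK_unitKInvStep (d := d) (Lc := Lc) j) c hXcov κ u κ' u' ((Lc : ℤ) • t))
      (fun κ u κ' u' => hXcov κ u κ' u' t) κ u κ' u', fun κ κ' κ₁ κ₂ => ?_⟩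
  have e1 : zmode Lc (lin4 c (unitK (sfStep Lc j) (smStep d Lc j) (KInvStep (d := d) Lc j)) Lc X - X) κ κ' (Sum.inl κ₁) (Sum.inl κ₂) = _ :=
    zmode_sub (N := Lc) (hA.mono (min_le_left _ _)) (hX.mono (min_le_right _ _)) hρ κ κ' (Sum.inl κ₁) (Sum.inl κ₂)
  have e2 : zmode Lc (lin4 c (unitK (sfStep Lc j) (smStep d Lc j) (KInvStep (d := d) Lc j)) Lc X - X) κ' κ (Sum.inl κ₁) (Sum.inl κ₂) = _ :=
    zmode_sub (N := Lc) (hA.mono (min_le_left _ _)) (hX.mono (min_le_right _ _)) hρ κ' κ (Sum.inl κ₁) (Sum.inl κ₂)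
  rw [e1, e2]
  have h := zsym_lin4_step_eq hLc j hc hX hδ hXcov κ κ' κ₁ κ₂
  linarith

/-- NOT IN PRINT; OUR BOOKKEEPING ([folklore] `zfreeSym_lin4_sub_self` + leaf-01 g63's `zfreeSym_add`, `abel`).  **ROAD W3's `hZ0` SLOT FROM A ONE-STEP RECURSION**: at the
conserving scalar, if `X′ = 𝒜^K_j X + G` with `X` a jointly covariant `LocStencil₂` table (ANY charge) and `G` a `LocStencil₂` table carrying the `ZfreeSym` text, then the
first difference `X′ − X` carries the `ZfreeSym` text. -/
theorem zfreeSym_succ_sub (hLc : 1 ≤ Lc) (j : ℕ) {c : ℝ}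
    (hc : ((Lc : ℝ) ^ (d + 1)) * (c * ((1 / 2 : ℝ) * (((Lc : ℝ) ^ (d + 1 + 1))⁻¹) ^ 4)) * 2 = 1)
    {X G X' : Tab d} {CT δ CG δG : ℝ} (hX : LocStencil₂ X CT δ) (hδ : 0 < δ)
    (hXcov : ∀ κ u κ' u' t, X κ (u + (Lc : ℤ) • t) κ' (u' + (Lc : ℤ) • t) = shiftK (-((Lc : ℤ) • t)) (X κ u κ' u'))
    (hG : LocStencil₂ G CG δG) (hδG : 0 < δG)
    (hZG : (∀ (κ : Fin (d + 1)) (u : Fin (d + 1) → ℤ) (κ' : Fin (d + 1)) (u' t : Fin (d + 1) → ℤ),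
        G κ (u + (Lc : ℤ) • t) κ' (u' + (Lc : ℤ) • t) = shiftK (-((Lc : ℤ) • t)) (G κ u κ' u')) ∧
      (∀ κ κ' κ₁ κ₂, zmode Lc G κ κ' (Sum.inl κ₁) (Sum.inl κ₂) + zmode Lc G κ' κ (Sum.inl κ₁) (Sum.inl κ₂) = 0))
    (hX' : X' = lin4 c (unitK (sfStep Lc j) (smStep d Lc j) (KInvStep (d := d) Lc j)) Lc X + G) :
    (∀ (κ : Fin (d + 1)) (u : Fin (d + 1) → ℤ) (κ' : Fin (d + 1)) (u' t : Fin (d + 1) → ℤ),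
        (X' - X) κ (u + (Lc : ℤ) • t) κ' (u' + (Lc : ℤ) • t) = shiftK (-((Lc : ℤ) • t)) ((X' - X) κ u κ' u')) ∧
      (∀ κ κ' κ₁ κ₂, zmode Lc (X' - X) κ κ' (Sum.inl κ₁) (Sum.inl κ₂) + zmode Lc (X' - X) κ' κ (Sum.inl κ₁) (Sum.inl κ₂) = 0) := by
  subst hX'
  have e : lin4 c (unitK (sfStep Lc j) (smStep d Lc j) (KInvStep (d := d) Lc j)) Lc X + G - X
      = (lin4 c (unitK (sfStep Lc j) (smStep d Lc j) (KInvStep (d := d) Lc j)) Lc X - X) + G := by abel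
  rw [e]
  obtain ⟨m, C, hm, hC, hK⟩ := decays_KInvStep (Lc := Lc) (d := d) j
  have hA := locStencil₂_lin4 (decays_unitK (sf := sfStep Lc j) (sm := smStep d Lc j) hK) (by positivity) hm hLc c hX hδ
  have hρ : 0 < min (min (min m δ / 128) δ) δG := lt_min (lt_min (by positivity) hδ) hδG
  exact zfreeSym_add ((locStencil₂_sub (hA.mono (min_le_left _ _)) (hX.mono (min_le_right _ _))).mono (min_le_left _ _))
    (hG.mono (min_le_right _ _)) hρ (zfreeSym_lin4_sub_self hLc j hc hX hδ hXcov) hZG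

end Generic

/-- [folklore] **THE EXACT PIN IS THE CONSERVING SCALAR AT `d = 3`**: `cE₂ = +Lc⁸` ⟹ `Lc⁴·((cE₂·Lc⁸)·½·(Lc⁵)⁻⁴)·2 = 1`. -/
theorem pinConst_three {Lc : ℕ} (hLc : 1 ≤ Lc) {cE₂ : ℝ} (hpinEq : cE₂ = (Lc : ℝ) ^ (2 * (3 + 1))) :
    ((Lc : ℝ) ^ (3 + 1)) * ((cE₂ * (Lc : ℝ) ^ (2 * (3 + 1))) * ((1 / 2 : ℝ) * (((Lc : ℝ) ^ (3 + 1 + 1))⁻¹) ^ 4)) * 2 = 1 := by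
  have hL : (Lc : ℝ) ≠ 0 := by
    have : (1 : ℝ) ≤ Lc := by exact_mod_cast hLc
    positivity
  subst hpinEq
  field_simp
  ring

/-! ## §2 `d = 3`: the DRIFT socket instance at the `ε`-member, relative-source rows displayed -/

section Three

variable {Lc : ℕ} [NeZero Lc] {r : Fin (3 + 1) → ℕ}

/-- NOT IN PRINT; OUR BOOKKEEPING ([folklore] composition — see the module docstring for every slot).  **THE DRIFT SOCKET INSTANCE AT THE `ε`-MEMBER** (`d = 3`,
`2 ≤ Lc`, in-block root `r`, the EXACT pin `cE₂ = +Lc⁸`, every `ε`, every `cE cVH cΛ cB Tc`, every jointly `Lc`-covariant off-diagonal `LocStencil₂` border): under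
«T2Shape^{ε}» (`hy`), the two rows of the RELATIVE source `b^{rel,ε}_l = ½ • (b̃_l + ε • P b̃_l) + (𝒜^Ĝ_l y_l − 𝒜^K_l y_l)` — uniformly `LocStencil₂` (`hb`) and
`ZfreeSym` (`hZ`), PART 1's binders verbatim — and its one-step DRIFT row (`hbd`), the `ε`-member `y_n = ½ • (T̃_n + ε • P T̃_n)` has road W3's «T2Drift»: ONE-STEP
geometric rate and CAUCHY form at one rate. -/
theorem rate_halfMember_three_of_relSource_rows (hLc : 2 ≤ Lc) (hr : r ∈ box (3 + 1) Lc) (cE cVH cΛ cE₂ cB : ℝ)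
    (hpinEq : cE₂ = (Lc : ℝ) ^ (2 * (3 + 1))) (Tc : Fin 4 → Fin 4 → Fin 4 → Fin 4 → ℝ)
    {vh₂S : Fin (3 + 1) → (Fin (3 + 1) → ℤ) → Fin (3 + 1) → (Fin (3 + 1) → ℤ) → MKer (3 + 1) (Fib 3)}
    (hBff : ∀ κ u κ' u' x z (α β : Fin (3 + 1)), vh₂S κ u κ' u' x z (Sum.inl α) (Sum.inl β) = 0)
    (hBmm : ∀ κ u κ' u' x z (μ ν : Fin (3 + 1)), vh₂S κ u κ' u' x z (Sum.inr μ) (Sum.inr ν) = 0)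
    {CB δB : ℝ} (hB : LocStencil₂ vh₂S CB δB) (hδB : 0 < δB)
    (hBt : ∀ (κ : Fin (3 + 1)) (u : Fin (3 + 1) → ℤ) (κ' : Fin (3 + 1)) (u' t : Fin (3 + 1) → ℤ),
        vh₂S κ (u + (Lc : ℤ) • t) κ' (u' + (Lc : ℤ) • t) = shiftK (-((Lc : ℤ) • t)) (vh₂S κ u κ' u'))
    (ε : ℝ) {Cy δy Cb δb Cbd θb δbd : ℝ}
    (hy : ∀ n, LocStencil₂ (((1 : ℝ) / 2) • (unitS₂ (sfStep Lc n) (smStep 3 Lc n) (T2RecAt 3 Lc (toSite r) cE cVH cΛ cE₂ cB Tc vh₂S (mixFFAt (toSite r) Lc) n) + ε • fun κ u κ' u' => sgnK (trK ((unitS₂ (sfStep Lc n)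
      (smStep 3 Lc n) (T2RecAt 3 Lc (toSite r) cE cVH cΛ cE₂ cB Tc vh₂S (mixFFAt (toSite r) Lc) n)) κ u κ' u')))) Cy δy) (hδy : 0 < δy)
    (hb : ∀ l, LocStencil₂
      (((1 : ℝ) / 2) • ((fun κ u κ' u' => (cE₂ * (Lc : ℝ) ^ (2 * (3 + 1))) • mmRead Lc (K3OfK (unitK (sfStep Lc l) (smStep 3 Lc l) (coDressKBmAt (toSite r) Lc (KInvStep (d := 3) Lc l))) Lc (unitS
        (sfStep Lc l) (smStep 3 Lc l) (SpureRecAt 3 Lc (toSite r) cE cVH cΛ l)) (unitM (sfStep Lc l) (smStep 3 Lc l) (M1At 3 Lc (toSite r) cΛ l)) (W2SymOfK (unitK (sfStep Lc l) (smStep 3 Lc l)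
        (coDressKBmAt (toSite r) Lc (KInvStep (d := 3) Lc l))) Lc (unitS (sfStep Lc l) (smStep 3 Lc l) (SpureRecAt 3 Lc (toSite r) cE cVH cΛ l)) (unitM (sfStep Lc l) (smStep 3 Lc l) (M1At 3 Lc
        (toSite r) cΛ l)) 0 (unitM₂ (sfStep Lc l) (smStep 3 Lc l) (M2Of 3 Lc (mixFFAt (toSite r) Lc) l))) κ u κ' u') + cB • vh₂S κ u κ' u') + ε • fun κ u κ' u' => sgnK (trK ((cE₂ * (Lc : ℝ) ^ (2
        * (3 + 1))) • mmRead Lc (K3OfK (unitK (sfStep Lc l) (smStep 3 Lc l) (coDressKBmAt (toSite r) Lc (KInvStep (d := 3) Lc l))) Lc (unitS (sfStep Lc l) (smStep 3 Lc l) (SpureRecAt 3 Lc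
        (toSite r) cE cVH cΛ l)) (unitM (sfStep Lc l) (smStep 3 Lc l) (M1At 3 Lc (toSite r) cΛ l)) (W2SymOfK (unitK (sfStep Lc l) (smStep 3 Lc l) (coDressKBmAt (toSite r) Lc (KInvStep (d := 3)
        Lc l))) Lc (unitS (sfStep Lc l) (smStep 3 Lc l) (SpureRecAt 3 Lc (toSite r) cE cVH cΛ l)) (unitM (sfStep Lc l) (smStep 3 Lc l) (M1At 3 Lc (toSite r) cΛ l)) 0 (unitM₂ (sfStep Lc l)
        (smStep 3 Lc l) (M2Of 3 Lc (mixFFAt (toSite r) Lc) l))) κ u κ' u') + cB • vh₂S κ u κ' u'))) + (lin4 (cE₂ * (Lc : ℝ) ^ (2 * (3 + 1))) (unitK (sfStep Lc l) (smStep 3 Lc l) (coDressKBmAt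
        (toSite r) Lc (KInvStep (d := 3) Lc l))) Lc (((1 : ℝ) / 2) • (unitS₂ (sfStep Lc l) (smStep 3 Lc l) (T2RecAt 3 Lc (toSite r) cE cVH cΛ cE₂ cB Tc vh₂S (mixFFAt (toSite r) Lc) l) + ε • fun
        κ u κ' u' => sgnK (trK ((unitS₂ (sfStep Lc l) (smStep 3 Lc l) (T2RecAt 3 Lc (toSite r) cE cVH cΛ cE₂ cB Tc vh₂S (mixFFAt (toSite r) Lc) l)) κ u κ' u')))) - lin4 (cE₂ * (Lc : ℝ) ^ (2 * (3
        + 1))) (unitK (sfStep Lc l) (smStep 3 Lc l) (KInvStep (d := 3) Lc l)) Lc (((1 : ℝ) / 2) • (unitS₂ (sfStep Lc l) (smStep 3 Lc l) (T2RecAt 3 Lc (toSite r) cE cVH cΛ cE₂ cB Tc vh₂S (mixFFAt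
        (toSite r) Lc) l) + ε • fun κ u κ' u' => sgnK (trK ((unitS₂ (sfStep Lc l) (smStep 3 Lc l) (T2RecAt 3 Lc (toSite r) cE cVH cΛ cE₂ cB Tc vh₂S (mixFFAt (toSite r) Lc) l)) κ u κ' u')))))) Cb δb)
    (hδb : 0 < δb)
    (hZ : ∀ l,
      (∀ (κ : Fin (3 + 1)) (u : Fin (3 + 1) → ℤ) (κ' : Fin (3 + 1)) (u' t : Fin (3 + 1) → ℤ), (((1 : ℝ) / 2) • ((fun κ u κ' u' => (cE₂ * (Lc : ℝ) ^ (2 * (3 + 1))) • mmRead Lc (K3OfK (unitK (sfStep Lc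
        l) (smStep 3 Lc l) (coDressKBmAt (toSite r) Lc (KInvStep (d := 3) Lc l))) Lc (unitS (sfStep Lc l) (smStep 3 Lc l) (SpureRecAt 3 Lc (toSite r) cE cVH cΛ l)) (unitM (sfStep Lc l) (smStep 3
        Lc l) (M1At 3 Lc (toSite r) cΛ l)) (W2SymOfK (unitK (sfStep Lc l) (smStep 3 Lc l) (coDressKBmAt (toSite r) Lc (KInvStep (d := 3) Lc l))) Lc (unitS (sfStep Lc l) (smStep 3 Lc l)
        (SpureRecAt 3 Lc (toSite r) cE cVH cΛ l)) (unitM (sfStep Lc l) (smStep 3 Lc l) (M1At 3 Lc (toSite r) cΛ l)) 0 (unitM₂ (sfStep Lc l) (smStep 3 Lc l) (M2Of 3 Lc (mixFFAt (toSite r) Lc)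
        l))) κ u κ' u') + cB • vh₂S κ u κ' u') + ε • fun κ u κ' u' => sgnK (trK ((cE₂ * (Lc : ℝ) ^ (2 * (3 + 1))) • mmRead Lc (K3OfK (unitK (sfStep Lc l) (smStep 3 Lc l) (coDressKBmAt (toSite r)
        Lc (KInvStep (d := 3) Lc l))) Lc (unitS (sfStep Lc l) (smStep 3 Lc l) (SpureRecAt 3 Lc (toSite r) cE cVH cΛ l)) (unitM (sfStep Lc l) (smStep 3 Lc l) (M1At 3 Lc (toSite r) cΛ l))
        (W2SymOfK (unitK (sfStep Lc l) (smStep 3 Lc l) (coDressKBmAt (toSite r) Lc (KInvStep (d := 3) Lc l))) Lc (unitS (sfStep Lc l) (smStep 3 Lc l) (SpureRecAt 3 Lc (toSite r) cE cVH cΛ l))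
        (unitM (sfStep Lc l) (smStep 3 Lc l) (M1At 3 Lc (toSite r) cΛ l)) 0 (unitM₂ (sfStep Lc l) (smStep 3 Lc l) (M2Of 3 Lc (mixFFAt (toSite r) Lc) l))) κ u κ' u') + cB • vh₂S κ u κ' u'))) +
        (lin4 (cE₂ * (Lc : ℝ) ^ (2 * (3 + 1))) (unitK (sfStep Lc l) (smStep 3 Lc l) (coDressKBmAt (toSite r) Lc (KInvStep (d := 3) Lc l))) Lc (((1 : ℝ) / 2) • (unitS₂ (sfStep Lc l) (smStep 3 Lc
        l) (T2RecAt 3 Lc (toSite r) cE cVH cΛ cE₂ cB Tc vh₂S (mixFFAt (toSite r) Lc) l) + ε • fun κ u κ' u' => sgnK (trK ((unitS₂ (sfStep Lc l) (smStep 3 Lc l) (T2RecAt 3 Lc (toSite r) cE cVH cΛ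
        cE₂ cB Tc vh₂S (mixFFAt (toSite r) Lc) l)) κ u κ' u')))) - lin4 (cE₂ * (Lc : ℝ) ^ (2 * (3 + 1))) (unitK (sfStep Lc l) (smStep 3 Lc l) (KInvStep (d := 3) Lc l)) Lc (((1 : ℝ) / 2) •
        (unitS₂ (sfStep Lc l) (smStep 3 Lc l) (T2RecAt 3 Lc (toSite r) cE cVH cΛ cE₂ cB Tc vh₂S (mixFFAt (toSite r) Lc) l) + ε • fun κ u κ' u' => sgnK (trK ((unitS₂ (sfStep Lc l) (smStep 3 Lc l)
        (T2RecAt 3 Lc (toSite r) cE cVH cΛ cE₂ cB Tc vh₂S (mixFFAt (toSite r) Lc) l)) κ u κ' u')))))) κ (u + (Lc : ℤ) • t) κ' (u' + (Lc : ℤ) • t) = shiftK (-((Lc : ℤ) • t)) ((((1 : ℝ) / 2) •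
        ((fun κ u κ' u' => (cE₂ * (Lc : ℝ) ^ (2 * (3 + 1))) • mmRead Lc (K3OfK (unitK (sfStep Lc l) (smStep 3 Lc l) (coDressKBmAt (toSite r) Lc (KInvStep (d := 3) Lc l))) Lc (unitS (sfStep Lc l)
        (smStep 3 Lc l) (SpureRecAt 3 Lc (toSite r) cE cVH cΛ l)) (unitM (sfStep Lc l) (smStep 3 Lc l) (M1At 3 Lc (toSite r) cΛ l)) (W2SymOfK (unitK (sfStep Lc l) (smStep 3 Lc l) (coDressKBmAt
        (toSite r) Lc (KInvStep (d := 3) Lc l))) Lc (unitS (sfStep Lc l) (smStep 3 Lc l) (SpureRecAt 3 Lc (toSite r) cE cVH cΛ l)) (unitM (sfStep Lc l) (smStep 3 Lc l) (M1At 3 Lc (toSite r) cΛ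
        l)) 0 (unitM₂ (sfStep Lc l) (smStep 3 Lc l) (M2Of 3 Lc (mixFFAt (toSite r) Lc) l))) κ u κ' u') + cB • vh₂S κ u κ' u') + ε • fun κ u κ' u' => sgnK (trK ((cE₂ * (Lc : ℝ) ^ (2 * (3 + 1))) •
        mmRead Lc (K3OfK (unitK (sfStep Lc l) (smStep 3 Lc l) (coDressKBmAt (toSite r) Lc (KInvStep (d := 3) Lc l))) Lc (unitS (sfStep Lc l) (smStep 3 Lc l) (SpureRecAt 3 Lc (toSite r) cE cVH cΛ
        l)) (unitM (sfStep Lc l) (smStep 3 Lc l) (M1At 3 Lc (toSite r) cΛ l)) (W2SymOfK (unitK (sfStep Lc l) (smStep 3 Lc l) (coDressKBmAt (toSite r) Lc (KInvStep (d := 3) Lc l))) Lc (unitS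
        (sfStep Lc l) (smStep 3 Lc l) (SpureRecAt 3 Lc (toSite r) cE cVH cΛ l)) (unitM (sfStep Lc l) (smStep 3 Lc l) (M1At 3 Lc (toSite r) cΛ l)) 0 (unitM₂ (sfStep Lc l) (smStep 3 Lc l) (M2Of 3
        Lc (mixFFAt (toSite r) Lc) l))) κ u κ' u') + cB • vh₂S κ u κ' u'))) + (lin4 (cE₂ * (Lc : ℝ) ^ (2 * (3 + 1))) (unitK (sfStep Lc l) (smStep 3 Lc l) (coDressKBmAt (toSite r) Lc (KInvStep (d
        := 3) Lc l))) Lc (((1 : ℝ) / 2) • (unitS₂ (sfStep Lc l) (smStep 3 Lc l) (T2RecAt 3 Lc (toSite r) cE cVH cΛ cE₂ cB Tc vh₂S (mixFFAt (toSite r) Lc) l) + ε • fun κ u κ' u' => sgnK (trK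
        ((unitS₂ (sfStep Lc l) (smStep 3 Lc l) (T2RecAt 3 Lc (toSite r) cE cVH cΛ cE₂ cB Tc vh₂S (mixFFAt (toSite r) Lc) l)) κ u κ' u')))) - lin4 (cE₂ * (Lc : ℝ) ^ (2 * (3 + 1))) (unitK (sfStep
        Lc l) (smStep 3 Lc l) (KInvStep (d := 3) Lc l)) Lc (((1 : ℝ) / 2) • (unitS₂ (sfStep Lc l) (smStep 3 Lc l) (T2RecAt 3 Lc (toSite r) cE cVH cΛ cE₂ cB Tc vh₂S (mixFFAt (toSite r) Lc) l) + ε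
        • fun κ u κ' u' => sgnK (trK ((unitS₂ (sfStep Lc l) (smStep 3 Lc l) (T2RecAt 3 Lc (toSite r) cE cVH cΛ cE₂ cB Tc vh₂S (mixFFAt (toSite r) Lc) l)) κ u κ' u')))))) κ u κ' u')) ∧
      (∀ κ κ' κ₁ κ₂, zmode Lc (((1 : ℝ) / 2) • ((fun κ u κ' u' => (cE₂ * (Lc : ℝ) ^ (2 * (3 + 1))) • mmRead Lc (K3OfK (unitK (sfStep Lc l) (smStep 3 Lc l) (coDressKBmAt (toSite r) Lc (KInvStep (d :=
        3) Lc l))) Lc (unitS (sfStep Lc l) (smStep 3 Lc l) (SpureRecAt 3 Lc (toSite r) cE cVH cΛ l)) (unitM (sfStep Lc l) (smStep 3 Lc l) (M1At 3 Lc (toSite r) cΛ l)) (W2SymOfK (unitK (sfStep Lc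
        l) (smStep 3 Lc l) (coDressKBmAt (toSite r) Lc (KInvStep (d := 3) Lc l))) Lc (unitS (sfStep Lc l) (smStep 3 Lc l) (SpureRecAt 3 Lc (toSite r) cE cVH cΛ l)) (unitM (sfStep Lc l) (smStep 3
        Lc l) (M1At 3 Lc (toSite r) cΛ l)) 0 (unitM₂ (sfStep Lc l) (smStep 3 Lc l) (M2Of 3 Lc (mixFFAt (toSite r) Lc) l))) κ u κ' u') + cB • vh₂S κ u κ' u') + ε • fun κ u κ' u' => sgnK (trK
        ((cE₂ * (Lc : ℝ) ^ (2 * (3 + 1))) • mmRead Lc (K3OfK (unitK (sfStep Lc l) (smStep 3 Lc l) (coDressKBmAt (toSite r) Lc (KInvStep (d := 3) Lc l))) Lc (unitS (sfStep Lc l) (smStep 3 Lc l)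
        (SpureRecAt 3 Lc (toSite r) cE cVH cΛ l)) (unitM (sfStep Lc l) (smStep 3 Lc l) (M1At 3 Lc (toSite r) cΛ l)) (W2SymOfK (unitK (sfStep Lc l) (smStep 3 Lc l) (coDressKBmAt (toSite r) Lc
        (KInvStep (d := 3) Lc l))) Lc (unitS (sfStep Lc l) (smStep 3 Lc l) (SpureRecAt 3 Lc (toSite r) cE cVH cΛ l)) (unitM (sfStep Lc l) (smStep 3 Lc l) (M1At 3 Lc (toSite r) cΛ l)) 0 (unitM₂
        (sfStep Lc l) (smStep 3 Lc l) (M2Of 3 Lc (mixFFAt (toSite r) Lc) l))) κ u κ' u') + cB • vh₂S κ u κ' u'))) + (lin4 (cE₂ * (Lc : ℝ) ^ (2 * (3 + 1))) (unitK (sfStep Lc l) (smStep 3 Lc l)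
        (coDressKBmAt (toSite r) Lc (KInvStep (d := 3) Lc l))) Lc (((1 : ℝ) / 2) • (unitS₂ (sfStep Lc l) (smStep 3 Lc l) (T2RecAt 3 Lc (toSite r) cE cVH cΛ cE₂ cB Tc vh₂S (mixFFAt (toSite r) Lc)
        l) + ε • fun κ u κ' u' => sgnK (trK ((unitS₂ (sfStep Lc l) (smStep 3 Lc l) (T2RecAt 3 Lc (toSite r) cE cVH cΛ cE₂ cB Tc vh₂S (mixFFAt (toSite r) Lc) l)) κ u κ' u')))) - lin4 (cE₂ * (Lc :
        ℝ) ^ (2 * (3 + 1))) (unitK (sfStep Lc l) (smStep 3 Lc l) (KInvStep (d := 3) Lc l)) Lc (((1 : ℝ) / 2) • (unitS₂ (sfStep Lc l) (smStep 3 Lc l) (T2RecAt 3 Lc (toSite r) cE cVH cΛ cE₂ cB Tc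
        vh₂S (mixFFAt (toSite r) Lc) l) + ε • fun κ u κ' u' => sgnK (trK ((unitS₂ (sfStep Lc l) (smStep 3 Lc l) (T2RecAt 3 Lc (toSite r) cE cVH cΛ cE₂ cB Tc vh₂S (mixFFAt (toSite r) Lc) l)) κ u
        κ' u')))))) κ κ' (Sum.inl κ₁) (Sum.inl κ₂) + zmode Lc (((1 : ℝ) / 2) • ((fun κ u κ' u' => (cE₂ * (Lc : ℝ) ^ (2 * (3 + 1))) • mmRead Lc (K3OfK (unitK (sfStep Lc l) (smStep 3 Lc l)
        (coDressKBmAt (toSite r) Lc (KInvStep (d := 3) Lc l))) Lc (unitS (sfStep Lc l) (smStep 3 Lc l) (SpureRecAt 3 Lc (toSite r) cE cVH cΛ l)) (unitM (sfStep Lc l) (smStep 3 Lc l) (M1At 3 Lc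
        (toSite r) cΛ l)) (W2SymOfK (unitK (sfStep Lc l) (smStep 3 Lc l) (coDressKBmAt (toSite r) Lc (KInvStep (d := 3) Lc l))) Lc (unitS (sfStep Lc l) (smStep 3 Lc l) (SpureRecAt 3 Lc (toSite
        r) cE cVH cΛ l)) (unitM (sfStep Lc l) (smStep 3 Lc l) (M1At 3 Lc (toSite r) cΛ l)) 0 (unitM₂ (sfStep Lc l) (smStep 3 Lc l) (M2Of 3 Lc (mixFFAt (toSite r) Lc) l))) κ u κ' u') + cB • vh₂S
        κ u κ' u') + ε • fun κ u κ' u' => sgnK (trK ((cE₂ * (Lc : ℝ) ^ (2 * (3 + 1))) • mmRead Lc (K3OfK (unitK (sfStep Lc l) (smStep 3 Lc l) (coDressKBmAt (toSite r) Lc (KInvStep (d := 3) Lc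
        l))) Lc (unitS (sfStep Lc l) (smStep 3 Lc l) (SpureRecAt 3 Lc (toSite r) cE cVH cΛ l)) (unitM (sfStep Lc l) (smStep 3 Lc l) (M1At 3 Lc (toSite r) cΛ l)) (W2SymOfK (unitK (sfStep Lc l)
        (smStep 3 Lc l) (coDressKBmAt (toSite r) Lc (KInvStep (d := 3) Lc l))) Lc (unitS (sfStep Lc l) (smStep 3 Lc l) (SpureRecAt 3 Lc (toSite r) cE cVH cΛ l)) (unitM (sfStep Lc l) (smStep 3 Lc
        l) (M1At 3 Lc (toSite r) cΛ l)) 0 (unitM₂ (sfStep Lc l) (smStep 3 Lc l) (M2Of 3 Lc (mixFFAt (toSite r) Lc) l))) κ u κ' u') + cB • vh₂S κ u κ' u'))) + (lin4 (cE₂ * (Lc : ℝ) ^ (2 * (3 +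
        1))) (unitK (sfStep Lc l) (smStep 3 Lc l) (coDressKBmAt (toSite r) Lc (KInvStep (d := 3) Lc l))) Lc (((1 : ℝ) / 2) • (unitS₂ (sfStep Lc l) (smStep 3 Lc l) (T2RecAt 3 Lc (toSite r) cE cVH
        cΛ cE₂ cB Tc vh₂S (mixFFAt (toSite r) Lc) l) + ε • fun κ u κ' u' => sgnK (trK ((unitS₂ (sfStep Lc l) (smStep 3 Lc l) (T2RecAt 3 Lc (toSite r) cE cVH cΛ cE₂ cB Tc vh₂S (mixFFAt (toSite r)
        Lc) l)) κ u κ' u')))) - lin4 (cE₂ * (Lc : ℝ) ^ (2 * (3 + 1))) (unitK (sfStep Lc l) (smStep 3 Lc l) (KInvStep (d := 3) Lc l)) Lc (((1 : ℝ) / 2) • (unitS₂ (sfStep Lc l) (smStep 3 Lc l)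
        (T2RecAt 3 Lc (toSite r) cE cVH cΛ cE₂ cB Tc vh₂S (mixFFAt (toSite r) Lc) l) + ε • fun κ u κ' u' => sgnK (trK ((unitS₂ (sfStep Lc l) (smStep 3 Lc l) (T2RecAt 3 Lc (toSite r) cE cVH cΛ
        cE₂ cB Tc vh₂S (mixFFAt (toSite r) Lc) l)) κ u κ' u')))))) κ' κ (Sum.inl κ₁) (Sum.inl κ₂) = 0))
    (hbd : ∀ l, LocStencil₂
      ((((1 : ℝ) / 2) • ((fun κ u κ' u' => (cE₂ * (Lc : ℝ) ^ (2 * (3 + 1))) • mmRead Lc (K3OfK (unitK (sfStep Lc (l + 1)) (smStep 3 Lc (l + 1)) (coDressKBmAt (toSite r) Lc (KInvStep (d := 3) Lc (l +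
        1)))) Lc (unitS (sfStep Lc (l + 1)) (smStep 3 Lc (l + 1)) (SpureRecAt 3 Lc (toSite r) cE cVH cΛ (l + 1))) (unitM (sfStep Lc (l + 1)) (smStep 3 Lc (l + 1)) (M1At 3 Lc (toSite r) cΛ (l +
        1))) (W2SymOfK (unitK (sfStep Lc (l + 1)) (smStep 3 Lc (l + 1)) (coDressKBmAt (toSite r) Lc (KInvStep (d := 3) Lc (l + 1)))) Lc (unitS (sfStep Lc (l + 1)) (smStep 3 Lc (l + 1))
        (SpureRecAt 3 Lc (toSite r) cE cVH cΛ (l + 1))) (unitM (sfStep Lc (l + 1)) (smStep 3 Lc (l + 1)) (M1At 3 Lc (toSite r) cΛ (l + 1))) 0 (unitM₂ (sfStep Lc (l + 1)) (smStep 3 Lc (l + 1))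
        (M2Of 3 Lc (mixFFAt (toSite r) Lc) (l + 1)))) κ u κ' u') + cB • vh₂S κ u κ' u') + ε • fun κ u κ' u' => sgnK (trK ((cE₂ * (Lc : ℝ) ^ (2 * (3 + 1))) • mmRead Lc (K3OfK (unitK (sfStep Lc (l
        + 1)) (smStep 3 Lc (l + 1)) (coDressKBmAt (toSite r) Lc (KInvStep (d := 3) Lc (l + 1)))) Lc (unitS (sfStep Lc (l + 1)) (smStep 3 Lc (l + 1)) (SpureRecAt 3 Lc (toSite r) cE cVH cΛ (l +
        1))) (unitM (sfStep Lc (l + 1)) (smStep 3 Lc (l + 1)) (M1At 3 Lc (toSite r) cΛ (l + 1))) (W2SymOfK (unitK (sfStep Lc (l + 1)) (smStep 3 Lc (l + 1)) (coDressKBmAt (toSite r) Lc (KInvStep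
        (d := 3) Lc (l + 1)))) Lc (unitS (sfStep Lc (l + 1)) (smStep 3 Lc (l + 1)) (SpureRecAt 3 Lc (toSite r) cE cVH cΛ (l + 1))) (unitM (sfStep Lc (l + 1)) (smStep 3 Lc (l + 1)) (M1At 3 Lc
        (toSite r) cΛ (l + 1))) 0 (unitM₂ (sfStep Lc (l + 1)) (smStep 3 Lc (l + 1)) (M2Of 3 Lc (mixFFAt (toSite r) Lc) (l + 1)))) κ u κ' u') + cB • vh₂S κ u κ' u'))) + (lin4 (cE₂ * (Lc : ℝ) ^ (2
        * (3 + 1))) (unitK (sfStep Lc (l + 1)) (smStep 3 Lc (l + 1)) (coDressKBmAt (toSite r) Lc (KInvStep (d := 3) Lc (l + 1)))) Lc (((1 : ℝ) / 2) • (unitS₂ (sfStep Lc (l + 1)) (smStep 3 Lc (l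
        + 1)) (T2RecAt 3 Lc (toSite r) cE cVH cΛ cE₂ cB Tc vh₂S (mixFFAt (toSite r) Lc) (l + 1)) + ε • fun κ u κ' u' => sgnK (trK ((unitS₂ (sfStep Lc (l + 1)) (smStep 3 Lc (l + 1)) (T2RecAt 3 Lc
        (toSite r) cE cVH cΛ cE₂ cB Tc vh₂S (mixFFAt (toSite r) Lc) (l + 1))) κ u κ' u')))) - lin4 (cE₂ * (Lc : ℝ) ^ (2 * (3 + 1))) (unitK (sfStep Lc (l + 1)) (smStep 3 Lc (l + 1)) (KInvStep (d
        := 3) Lc (l + 1))) Lc (((1 : ℝ) / 2) • (unitS₂ (sfStep Lc (l + 1)) (smStep 3 Lc (l + 1)) (T2RecAt 3 Lc (toSite r) cE cVH cΛ cE₂ cB Tc vh₂S (mixFFAt (toSite r) Lc) (l + 1)) + ε • fun κ u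
        κ' u' => sgnK (trK ((unitS₂ (sfStep Lc (l + 1)) (smStep 3 Lc (l + 1)) (T2RecAt 3 Lc (toSite r) cE cVH cΛ cE₂ cB Tc vh₂S (mixFFAt (toSite r) Lc) (l + 1))) κ u κ' u')))))) -
       (((1 : ℝ) / 2) • ((fun κ u κ' u' => (cE₂ * (Lc : ℝ) ^ (2 * (3 + 1))) • mmRead Lc (K3OfK (unitK (sfStep Lc l) (smStep 3 Lc l) (coDressKBmAt (toSite r) Lc (KInvStep (d := 3) Lc l))) Lc (unitS
        (sfStep Lc l) (smStep 3 Lc l) (SpureRecAt 3 Lc (toSite r) cE cVH cΛ l)) (unitM (sfStep Lc l) (smStep 3 Lc l) (M1At 3 Lc (toSite r) cΛ l)) (W2SymOfK (unitK (sfStep Lc l) (smStep 3 Lc l)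
        (coDressKBmAt (toSite r) Lc (KInvStep (d := 3) Lc l))) Lc (unitS (sfStep Lc l) (smStep 3 Lc l) (SpureRecAt 3 Lc (toSite r) cE cVH cΛ l)) (unitM (sfStep Lc l) (smStep 3 Lc l) (M1At 3 Lc
        (toSite r) cΛ l)) 0 (unitM₂ (sfStep Lc l) (smStep 3 Lc l) (M2Of 3 Lc (mixFFAt (toSite r) Lc) l))) κ u κ' u') + cB • vh₂S κ u κ' u') + ε • fun κ u κ' u' => sgnK (trK ((cE₂ * (Lc : ℝ) ^ (2
        * (3 + 1))) • mmRead Lc (K3OfK (unitK (sfStep Lc l) (smStep 3 Lc l) (coDressKBmAt (toSite r) Lc (KInvStep (d := 3) Lc l))) Lc (unitS (sfStep Lc l) (smStep 3 Lc l) (SpureRecAt 3 Lc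
        (toSite r) cE cVH cΛ l)) (unitM (sfStep Lc l) (smStep 3 Lc l) (M1At 3 Lc (toSite r) cΛ l)) (W2SymOfK (unitK (sfStep Lc l) (smStep 3 Lc l) (coDressKBmAt (toSite r) Lc (KInvStep (d := 3)
        Lc l))) Lc (unitS (sfStep Lc l) (smStep 3 Lc l) (SpureRecAt 3 Lc (toSite r) cE cVH cΛ l)) (unitM (sfStep Lc l) (smStep 3 Lc l) (M1At 3 Lc (toSite r) cΛ l)) 0 (unitM₂ (sfStep Lc l)
        (smStep 3 Lc l) (M2Of 3 Lc (mixFFAt (toSite r) Lc) l))) κ u κ' u') + cB • vh₂S κ u κ' u'))) + (lin4 (cE₂ * (Lc : ℝ) ^ (2 * (3 + 1))) (unitK (sfStep Lc l) (smStep 3 Lc l) (coDressKBmAt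
        (toSite r) Lc (KInvStep (d := 3) Lc l))) Lc (((1 : ℝ) / 2) • (unitS₂ (sfStep Lc l) (smStep 3 Lc l) (T2RecAt 3 Lc (toSite r) cE cVH cΛ cE₂ cB Tc vh₂S (mixFFAt (toSite r) Lc) l) + ε • fun
        κ u κ' u' => sgnK (trK ((unitS₂ (sfStep Lc l) (smStep 3 Lc l) (T2RecAt 3 Lc (toSite r) cE cVH cΛ cE₂ cB Tc vh₂S (mixFFAt (toSite r) Lc) l)) κ u κ' u')))) - lin4 (cE₂ * (Lc : ℝ) ^ (2 * (3
        + 1))) (unitK (sfStep Lc l) (smStep 3 Lc l) (KInvStep (d := 3) Lc l)) Lc (((1 : ℝ) / 2) • (unitS₂ (sfStep Lc l) (smStep 3 Lc l) (T2RecAt 3 Lc (toSite r) cE cVH cΛ cE₂ cB Tc vh₂S (mixFFAt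
        (toSite r) Lc) l) + ε • fun κ u κ' u' => sgnK (trK ((unitS₂ (sfStep Lc l) (smStep 3 Lc l) (T2RecAt 3 Lc (toSite r) cE cVH cΛ cE₂ cB Tc vh₂S (mixFFAt (toSite r) Lc) l)) κ u κ' u'))))))) (Cbd * θb ^ l) δbd)
    (hθb0 : 0 ≤ θb) (hθb1 : θb < 1) (hδbd : 0 < δbd) :
    ∃ c ϑ δ : ℝ, 0 ≤ c ∧ 0 < ϑ ∧ ϑ < 1 ∧ 0 < δ ∧
      (∀ n, LocStencil₂
        ((((1 : ℝ) / 2) • (unitS₂ (sfStep Lc (n + 1)) (smStep 3 Lc (n + 1)) (T2RecAt 3 Lc (toSite r) cE cVH cΛ cE₂ cB Tc vh₂S (mixFFAt (toSite r) Lc) (n + 1)) + ε • fun κ u κ' u' => sgnK (trK ((unitS₂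
          (sfStep Lc (n + 1)) (smStep 3 Lc (n + 1)) (T2RecAt 3 Lc (toSite r) cE cVH cΛ cE₂ cB Tc vh₂S (mixFFAt (toSite r) Lc) (n + 1))) κ u κ' u')))) -
         (((1 : ℝ) / 2) • (unitS₂ (sfStep Lc n) (smStep 3 Lc n) (T2RecAt 3 Lc (toSite r) cE cVH cΛ cE₂ cB Tc vh₂S (mixFFAt (toSite r) Lc) n) + ε • fun κ u κ' u' => sgnK (trK ((unitS₂ (sfStep Lc n)
          (smStep 3 Lc n) (T2RecAt 3 Lc (toSite r) cE cVH cΛ cE₂ cB Tc vh₂S (mixFFAt (toSite r) Lc) n)) κ u κ' u'))))) (c * ϑ ^ n) δ) ∧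
      (∀ k j, LocStencil₂
        ((((1 : ℝ) / 2) • (unitS₂ (sfStep Lc (k + j)) (smStep 3 Lc (k + j)) (T2RecAt 3 Lc (toSite r) cE cVH cΛ cE₂ cB Tc vh₂S (mixFFAt (toSite r) Lc) (k + j)) + ε • fun κ u κ' u' => sgnK (trK ((unitS₂
          (sfStep Lc (k + j)) (smStep 3 Lc (k + j)) (T2RecAt 3 Lc (toSite r) cE cVH cΛ cE₂ cB Tc vh₂S (mixFFAt (toSite r) Lc) (k + j))) κ u κ' u')))) -
         (((1 : ℝ) / 2) • (unitS₂ (sfStep Lc k) (smStep 3 Lc k) (T2RecAt 3 Lc (toSite r) cE cVH cΛ cE₂ cB Tc vh₂S (mixFFAt (toSite r) Lc) k) + ε • fun κ u κ' u' => sgnK (trK ((unitS₂ (sfStep Lc k)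
          (smStep 3 Lc k) (T2RecAt 3 Lc (toSite r) cE cVH cΛ cE₂ cB Tc vh₂S (mixFFAt (toSite r) Lc) k)) κ u κ' u'))))) (c * (1 - ϑ)⁻¹ * ϑ ^ k) δ) := by
  have hLc1 : 1 ≤ Lc := le_trans (by norm_num) hLc
  have hpin : |cE₂| ≤ (Lc : ℝ) ^ (2 * (3 + 1)) := by
    rw [hpinEq, abs_of_nonneg (by positivity)]
  have hCy : 0 ≤ Cy := (hy 0).nonneg
  -- the one-step recursion of the `ε`-member in (R-HYB′) form: leaf-01 g72's `halfMember_succ_eq` re-based on road W3's undressed step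
  have hrec : ∀ j : ℕ,
      (((1 : ℝ) / 2) • (unitS₂ (sfStep Lc (j + 1)) (smStep 3 Lc (j + 1)) (T2RecAt 3 Lc (toSite r) cE cVH cΛ cE₂ cB Tc vh₂S (mixFFAt (toSite r) Lc) (j + 1)) + ε • fun κ u κ' u' => sgnK (trK ((unitS₂
        (sfStep Lc (j + 1)) (smStep 3 Lc (j + 1)) (T2RecAt 3 Lc (toSite r) cE cVH cΛ cE₂ cB Tc vh₂S (mixFFAt (toSite r) Lc) (j + 1))) κ u κ' u')))) =
      lin4 (cE₂ * (Lc : ℝ) ^ (2 * (3 + 1))) (unitK (sfStep Lc j) (smStep 3 Lc j) (KInvStep (d := 3) Lc j)) Lc (((1 : ℝ) / 2) • (unitS₂ (sfStep Lc j) (smStep 3 Lc j) (T2RecAt 3 Lc (toSite r) cE cVH cΛ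
        cE₂ cB Tc vh₂S (mixFFAt (toSite r) Lc) j) + ε • fun κ u κ' u' => sgnK (trK ((unitS₂ (sfStep Lc j) (smStep 3 Lc j) (T2RecAt 3 Lc (toSite r) cE cVH cΛ cE₂ cB Tc vh₂S (mixFFAt (toSite r)
        Lc) j)) κ u κ' u')))) +
      (((1 : ℝ) / 2) • ((fun κ u κ' u' => (cE₂ * (Lc : ℝ) ^ (2 * (3 + 1))) • mmRead Lc (K3OfK (unitK (sfStep Lc j) (smStep 3 Lc j) (coDressKBmAt (toSite r) Lc (KInvStep (d := 3) Lc j))) Lc (unitS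
        (sfStep Lc j) (smStep 3 Lc j) (SpureRecAt 3 Lc (toSite r) cE cVH cΛ j)) (unitM (sfStep Lc j) (smStep 3 Lc j) (M1At 3 Lc (toSite r) cΛ j)) (W2SymOfK (unitK (sfStep Lc j) (smStep 3 Lc j)
        (coDressKBmAt (toSite r) Lc (KInvStep (d := 3) Lc j))) Lc (unitS (sfStep Lc j) (smStep 3 Lc j) (SpureRecAt 3 Lc (toSite r) cE cVH cΛ j)) (unitM (sfStep Lc j) (smStep 3 Lc j) (M1At 3 Lc
        (toSite r) cΛ j)) 0 (unitM₂ (sfStep Lc j) (smStep 3 Lc j) (M2Of 3 Lc (mixFFAt (toSite r) Lc) j))) κ u κ' u') + cB • vh₂S κ u κ' u') + ε • fun κ u κ' u' => sgnK (trK ((cE₂ * (Lc : ℝ) ^ (2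
        * (3 + 1))) • mmRead Lc (K3OfK (unitK (sfStep Lc j) (smStep 3 Lc j) (coDressKBmAt (toSite r) Lc (KInvStep (d := 3) Lc j))) Lc (unitS (sfStep Lc j) (smStep 3 Lc j) (SpureRecAt 3 Lc
        (toSite r) cE cVH cΛ j)) (unitM (sfStep Lc j) (smStep 3 Lc j) (M1At 3 Lc (toSite r) cΛ j)) (W2SymOfK (unitK (sfStep Lc j) (smStep 3 Lc j) (coDressKBmAt (toSite r) Lc (KInvStep (d := 3)
        Lc j))) Lc (unitS (sfStep Lc j) (smStep 3 Lc j) (SpureRecAt 3 Lc (toSite r) cE cVH cΛ j)) (unitM (sfStep Lc j) (smStep 3 Lc j) (M1At 3 Lc (toSite r) cΛ j)) 0 (unitM₂ (sfStep Lc j)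
        (smStep 3 Lc j) (M2Of 3 Lc (mixFFAt (toSite r) Lc) j))) κ u κ' u') + cB • vh₂S κ u κ' u'))) + (lin4 (cE₂ * (Lc : ℝ) ^ (2 * (3 + 1))) (unitK (sfStep Lc j) (smStep 3 Lc j) (coDressKBmAt
        (toSite r) Lc (KInvStep (d := 3) Lc j))) Lc (((1 : ℝ) / 2) • (unitS₂ (sfStep Lc j) (smStep 3 Lc j) (T2RecAt 3 Lc (toSite r) cE cVH cΛ cE₂ cB Tc vh₂S (mixFFAt (toSite r) Lc) j) + ε • fun
        κ u κ' u' => sgnK (trK ((unitS₂ (sfStep Lc j) (smStep 3 Lc j) (T2RecAt 3 Lc (toSite r) cE cVH cΛ cE₂ cB Tc vh₂S (mixFFAt (toSite r) Lc) j)) κ u κ' u')))) - lin4 (cE₂ * (Lc : ℝ) ^ (2 * (3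
        + 1))) (unitK (sfStep Lc j) (smStep 3 Lc j) (KInvStep (d := 3) Lc j)) Lc (((1 : ℝ) / 2) • (unitS₂ (sfStep Lc j) (smStep 3 Lc j) (T2RecAt 3 Lc (toSite r) cE cVH cΛ cE₂ cB Tc vh₂S (mixFFAt
        (toSite r) Lc) j) + ε • fun κ u κ' u' => sgnK (trK ((unitS₂ (sfStep Lc j) (smStep 3 Lc j) (T2RecAt 3 Lc (toSite r) cE cVH cΛ cE₂ cB Tc vh₂S (mixFFAt (toSite r) Lc) j)) κ u κ' u')))))) := fun j => by
    have h := halfMember_succ_eq (d := 3) hLc1 hr cE cVH cΛ cE₂ cB Tc hBff hBmm ⟨CB, δB, hδB, hB⟩ ε j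
    beta_reduce at h
    rw [h]
    abel
  -- leaf-01's engine: the DIFFERENCE tower unrolled through the SHIFTED undressed transport, on the class of bounded bi-tables
  have hdiff := diff_eq_transport_add_sum
    (A := fun j => lin4 (cE₂ * (Lc : ℝ) ^ (2 * (3 + 1))) (unitK (sfStep Lc j) (smStep 3 Lc j) (KInvStep (d := 3) Lc j)) Lc)
    (P := fun X : BiTab 3 => ∃ B : ℝ, ∀ κ u κ' u' x z a b, |X κ u κ' u' x z a b| ≤ B)
    (x := fun n =>
      (((1 : ℝ) / 2) • (unitS₂ (sfStep Lc n) (smStep 3 Lc n) (T2RecAt 3 Lc (toSite r) cE cVH cΛ cE₂ cB Tc vh₂S (mixFFAt (toSite r) Lc) n) + ε • fun κ u κ' u' => sgnK (trK ((unitS₂ (sfStep Lc n)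
        (smStep 3 Lc n) (T2RecAt 3 Lc (toSite r) cE cVH cΛ cE₂ cB Tc vh₂S (mixFFAt (toSite r) Lc) n)) κ u κ' u')))))
    (b := fun l =>
      (((1 : ℝ) / 2) • ((fun κ u κ' u' => (cE₂ * (Lc : ℝ) ^ (2 * (3 + 1))) • mmRead Lc (K3OfK (unitK (sfStep Lc l) (smStep 3 Lc l) (coDressKBmAt (toSite r) Lc (KInvStep (d := 3) Lc l))) Lc (unitS
        (sfStep Lc l) (smStep 3 Lc l) (SpureRecAt 3 Lc (toSite r) cE cVH cΛ l)) (unitM (sfStep Lc l) (smStep 3 Lc l) (M1At 3 Lc (toSite r) cΛ l)) (W2SymOfK (unitK (sfStep Lc l) (smStep 3 Lc l)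
        (coDressKBmAt (toSite r) Lc (KInvStep (d := 3) Lc l))) Lc (unitS (sfStep Lc l) (smStep 3 Lc l) (SpureRecAt 3 Lc (toSite r) cE cVH cΛ l)) (unitM (sfStep Lc l) (smStep 3 Lc l) (M1At 3 Lc
        (toSite r) cΛ l)) 0 (unitM₂ (sfStep Lc l) (smStep 3 Lc l) (M2Of 3 Lc (mixFFAt (toSite r) Lc) l))) κ u κ' u') + cB • vh₂S κ u κ' u') + ε • fun κ u κ' u' => sgnK (trK ((cE₂ * (Lc : ℝ) ^ (2
        * (3 + 1))) • mmRead Lc (K3OfK (unitK (sfStep Lc l) (smStep 3 Lc l) (coDressKBmAt (toSite r) Lc (KInvStep (d := 3) Lc l))) Lc (unitS (sfStep Lc l) (smStep 3 Lc l) (SpureRecAt 3 Lc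
        (toSite r) cE cVH cΛ l)) (unitM (sfStep Lc l) (smStep 3 Lc l) (M1At 3 Lc (toSite r) cΛ l)) (W2SymOfK (unitK (sfStep Lc l) (smStep 3 Lc l) (coDressKBmAt (toSite r) Lc (KInvStep (d := 3)
        Lc l))) Lc (unitS (sfStep Lc l) (smStep 3 Lc l) (SpureRecAt 3 Lc (toSite r) cE cVH cΛ l)) (unitM (sfStep Lc l) (smStep 3 Lc l) (M1At 3 Lc (toSite r) cΛ l)) 0 (unitM₂ (sfStep Lc l)
        (smStep 3 Lc l) (M2Of 3 Lc (mixFFAt (toSite r) Lc) l))) κ u κ' u') + cB • vh₂S κ u κ' u'))) + (lin4 (cE₂ * (Lc : ℝ) ^ (2 * (3 + 1))) (unitK (sfStep Lc l) (smStep 3 Lc l) (coDressKBmAt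
        (toSite r) Lc (KInvStep (d := 3) Lc l))) Lc (((1 : ℝ) / 2) • (unitS₂ (sfStep Lc l) (smStep 3 Lc l) (T2RecAt 3 Lc (toSite r) cE cVH cΛ cE₂ cB Tc vh₂S (mixFFAt (toSite r) Lc) l) + ε • fun
        κ u κ' u' => sgnK (trK ((unitS₂ (sfStep Lc l) (smStep 3 Lc l) (T2RecAt 3 Lc (toSite r) cE cVH cΛ cE₂ cB Tc vh₂S (mixFFAt (toSite r) Lc) l)) κ u κ' u')))) - lin4 (cE₂ * (Lc : ℝ) ^ (2 * (3
        + 1))) (unitK (sfStep Lc l) (smStep 3 Lc l) (KInvStep (d := 3) Lc l)) Lc (((1 : ℝ) / 2) • (unitS₂ (sfStep Lc l) (smStep 3 Lc l) (T2RecAt 3 Lc (toSite r) cE cVH cΛ cE₂ cB Tc vh₂S (mixFFAt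
        (toSite r) Lc) l) + ε • fun κ u κ' u' => sgnK (trK ((unitS₂ (sfStep Lc l) (smStep 3 Lc l) (T2RecAt 3 Lc (toSite r) cE cVH cΛ cE₂ cB Tc vh₂S (mixFFAt (toSite r) Lc) l)) κ u κ' u')))))))
    bdd₄_zero (fun _ _ => bdd₄_add) (fun _ _ => bdd₄_sub) (lin4_bdd₄ cE₂) (lin4_add_bdd₄ cE₂) (bdd₄_of_locStencil₂ (hy 0) hδy.le)
    (fun j => bdd₄_of_locStencil₂ (hb j) hδb.le) hrec
  -- road P1's K-slot; the member's joint covariance (`T2DevCovariance` ⨾ PART 1 §1)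
  obtain ⟨CK, δK, cK, θK, hδK, hθK0, hθK1, hK, hKall⟩ := convCKWall_holds (Lc := Lc) hLc
  have hCK : 0 ≤ CK := (hK 0).nonneg (Sum.inl 0)
  have hycov := fun (n : ℕ) (κ : Fin (3 + 1)) (u : Fin (3 + 1) → ℤ) (κ' : Fin (3 + 1)) (u' t : Fin (3 + 1) → ℤ) =>
    translate_halfTable (fun κ u κ' u' t => unitS₂_T2RecAt_translate (r := r) hLc1 cE cVH cΛ cE₂ cB Tc hBt n κ u κ' u' t) ε κ u κ' u' t
  -- the forcing's RATE row (K-Cauchy × «T2Shape^ε» + the relative source's drift) and its `ZfreeSym` row (NO charge hypothesis + `hZ` at `m, m+1`)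
  obtain ⟨Cf, θf, δf, hCf, hθf0, hθf1, hδf, hf⟩ := exists_forcing_rate (d := 3) hLc1 (cE₂ * (Lc : ℝ) ^ (2 * (3 + 1))) _
    (fun l =>
      (((1 : ℝ) / 2) • ((fun κ u κ' u' => (cE₂ * (Lc : ℝ) ^ (2 * (3 + 1))) • mmRead Lc (K3OfK (unitK (sfStep Lc l) (smStep 3 Lc l) (coDressKBmAt (toSite r) Lc (KInvStep (d := 3) Lc l))) Lc (unitS
        (sfStep Lc l) (smStep 3 Lc l) (SpureRecAt 3 Lc (toSite r) cE cVH cΛ l)) (unitM (sfStep Lc l) (smStep 3 Lc l) (M1At 3 Lc (toSite r) cΛ l)) (W2SymOfK (unitK (sfStep Lc l) (smStep 3 Lc l)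
        (coDressKBmAt (toSite r) Lc (KInvStep (d := 3) Lc l))) Lc (unitS (sfStep Lc l) (smStep 3 Lc l) (SpureRecAt 3 Lc (toSite r) cE cVH cΛ l)) (unitM (sfStep Lc l) (smStep 3 Lc l) (M1At 3 Lc
        (toSite r) cΛ l)) 0 (unitM₂ (sfStep Lc l) (smStep 3 Lc l) (M2Of 3 Lc (mixFFAt (toSite r) Lc) l))) κ u κ' u') + cB • vh₂S κ u κ' u') + ε • fun κ u κ' u' => sgnK (trK ((cE₂ * (Lc : ℝ) ^ (2
        * (3 + 1))) • mmRead Lc (K3OfK (unitK (sfStep Lc l) (smStep 3 Lc l) (coDressKBmAt (toSite r) Lc (KInvStep (d := 3) Lc l))) Lc (unitS (sfStep Lc l) (smStep 3 Lc l) (SpureRecAt 3 Lc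
        (toSite r) cE cVH cΛ l)) (unitM (sfStep Lc l) (smStep 3 Lc l) (M1At 3 Lc (toSite r) cΛ l)) (W2SymOfK (unitK (sfStep Lc l) (smStep 3 Lc l) (coDressKBmAt (toSite r) Lc (KInvStep (d := 3)
        Lc l))) Lc (unitS (sfStep Lc l) (smStep 3 Lc l) (SpureRecAt 3 Lc (toSite r) cE cVH cΛ l)) (unitM (sfStep Lc l) (smStep 3 Lc l) (M1At 3 Lc (toSite r) cΛ l)) 0 (unitM₂ (sfStep Lc l)
        (smStep 3 Lc l) (M2Of 3 Lc (mixFFAt (toSite r) Lc) l))) κ u κ' u') + cB • vh₂S κ u κ' u'))) + (lin4 (cE₂ * (Lc : ℝ) ^ (2 * (3 + 1))) (unitK (sfStep Lc l) (smStep 3 Lc l) (coDressKBmAt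
        (toSite r) Lc (KInvStep (d := 3) Lc l))) Lc (((1 : ℝ) / 2) • (unitS₂ (sfStep Lc l) (smStep 3 Lc l) (T2RecAt 3 Lc (toSite r) cE cVH cΛ cE₂ cB Tc vh₂S (mixFFAt (toSite r) Lc) l) + ε • fun
        κ u κ' u' => sgnK (trK ((unitS₂ (sfStep Lc l) (smStep 3 Lc l) (T2RecAt 3 Lc (toSite r) cE cVH cΛ cE₂ cB Tc vh₂S (mixFFAt (toSite r) Lc) l)) κ u κ' u')))) - lin4 (cE₂ * (Lc : ℝ) ^ (2 * (3
        + 1))) (unitK (sfStep Lc l) (smStep 3 Lc l) (KInvStep (d := 3) Lc l)) Lc (((1 : ℝ) / 2) • (unitS₂ (sfStep Lc l) (smStep 3 Lc l) (T2RecAt 3 Lc (toSite r) cE cVH cΛ cE₂ cB Tc vh₂S (mixFFAt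
        (toSite r) Lc) l) + ε • fun κ u κ' u' => sgnK (trK ((unitS₂ (sfStep Lc l) (smStep 3 Lc l) (T2RecAt 3 Lc (toSite r) cE cVH cΛ cE₂ cB Tc vh₂S (mixFFAt (toSite r) Lc) l)) κ u κ' u')))))))
    hK hKall hδK hθK0 hθK1 hy hδy hbd hθb0 hθb1 hδbd
  have hZf := fun m : ℕ => zfreeSym_forcing (d := 3) hLc1 (m + 1) m (cE₂ * (Lc : ℝ) ^ (2 * (3 + 1))) (hK (m + 1)) (hK m) hCK hδK (hy m) hδy (hycov m)
    (hb m) (hb (m + 1)) hδb (hZ m) (hZ (m + 1))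
  -- the first difference: shape from «T2Shape^ε»; `ZfreeSym` from §1 at the exact pin and `hZ 0`
  have hδin : 0 < min δf δy := lt_min hδf hδy
  have hZ0 := zfreeSym_succ_sub (d := 3) hLc1 0 (pinConst_three hLc1 hpinEq) (hy 0) hδy (hycov 0) (hb 0) hδb (hZ 0) (hrec 0)
  -- road W3's END #2 socket certificate at the shifted undressed transport
  obtain ⟨c, ϑ, δT, hc, hϑ0, hϑ1, hδT, -, hD⟩ := rate_three_of_rows_F3b hLc hK hδK cE₂
    (fun n =>
      (((1 : ℝ) / 2) • (unitS₂ (sfStep Lc (n + 1)) (smStep 3 Lc (n + 1)) (T2RecAt 3 Lc (toSite r) cE cVH cΛ cE₂ cB Tc vh₂S (mixFFAt (toSite r) Lc) (n + 1)) + ε • fun κ u κ' u' => sgnK (trK ((unitS₂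
        (sfStep Lc (n + 1)) (smStep 3 Lc (n + 1)) (T2RecAt 3 Lc (toSite r) cE cVH cΛ cE₂ cB Tc vh₂S (mixFFAt (toSite r) Lc) (n + 1))) κ u κ' u')))) -
      (((1 : ℝ) / 2) • (unitS₂ (sfStep Lc n) (smStep 3 Lc n) (T2RecAt 3 Lc (toSite r) cE cVH cΛ cE₂ cB Tc vh₂S (mixFFAt (toSite r) Lc) n) + ε • fun κ u κ' u' => sgnK (trK ((unitS₂ (sfStep Lc n)
        (smStep 3 Lc n) (T2RecAt 3 Lc (toSite r) cE cVH cΛ cE₂ cB Tc vh₂S (mixFFAt (toSite r) Lc) n)) κ u κ' u')))))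
    _ (fun _ => (0 : ℝ)) hδin hθf0 hθf1 hpin (fun n => hdiff n)
    (fun m => ⟨(hf m).mono (min_le_left _ _), mul_nonneg hCf (pow_nonneg hθf0 m)⟩) hZf
    ⟨(locStencil₂_sub (hy (0 + 1)) (hy 0)).mono (min_le_right _ _), add_nonneg hCy (mul_nonneg (abs_nonneg _) hCy)⟩ hZ0
  refine ⟨c, ϑ, δT, hc, hϑ0, hϑ1, hδT, hD, fun k j => ?_⟩
  exact cauchy_of_rate (fun n =>
      (((1 : ℝ) / 2) • (unitS₂ (sfStep Lc n) (smStep 3 Lc n) (T2RecAt 3 Lc (toSite r) cE cVH cΛ cE₂ cB Tc vh₂S (mixFFAt (toSite r) Lc) n) + ε • fun κ u κ' u' => sgnK (trK ((unitS₂ (sfStep Lc n)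
        (smStep 3 Lc n) (T2RecAt 3 Lc (toSite r) cE cVH cΛ cE₂ cB Tc vh₂S (mixFFAt (toSite r) Lc) n)) κ u κ' u'))))) hc hϑ0.le hϑ1 hD k j

end Three

end Summit.QuantumFields.BalabanUV.Beta.GAN24.T2DriftEvenEnd

end
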